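import Mathlib
import Summits.Ventures.PercRepro.TriangleCapRowA2Last
import Summits.Ventures.PercRepro.TriangleCapRowA2LastArith5

/-!
# PercRepro — THE ROW `r = a + 2`, THE FINER MIXED READS FOR EVERY ROW `a ≥ 5` (p3, gen 48; part 201f′)

`rowA2_mixed_core'`: the core of the mixed read of part 201b for `d(z) ≥ 3` — the star centre is located through a
second in-side neighbour of `z` (each in-side neighbour misses some vertex, no vertex being at the cap) instead of a
second miss of `w₀`, which needed `d(z) ≥ 4`. `rowA2_last_mixed_two'` / `rowA2_last_mixed_one'`: the mixed reads at
`d = a − 2` / `d = a − 1` on `(k, a, a + 2)` for every `5 ≤ a` (the primed arithmetic of part 201e). Axioms: standard.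
-/

namespace PercRepro

namespace TriangleCap

namespace C047

open Finset

variable {V : Type*} [Fintype V] [DecidableEq V]

/-- **THE CORE OF THE MIXED READ, FOR `d(z) ≥ 3`** (the version of part 201b with the star centre located through a
second in-side neighbour instead of a second miss of `w₀`; `D − z ⊆ K(A′, A′ᶜ)`, `|A′| = a`, `d(z) ≥ 3`, a neighbour `w₀` of `z` off the
side and a neighbour `w₁` on it, no vertex at the cap): with `t` in-side and `s₀` off-side neighbours of `z`,
`T = Σ_{w ∼ z} deg (D − z) w` obeys one of: `s₀ ≥ 2` and `T ≤ t (k − a − s₀) + s₀ (a + 1 − t)`; `s₀ = 1`, the missing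
graph of `D − z` is not a star and `T ≤ t (k − a − 2) + (a + 1 − t)`; `s₀ = 1`, `d(z) + 2 ≤ a` and
`T ≤ t (k − a − 2) + (a − (d(z) + 2))` (the missing graph is a star at `w₀`, which misses `d(z) + 2` vertices of `A′`). -/
theorem rowA2_mixed_core' (D : SimpleGraph V) [DecidableRel D.Adj] (hK : K4mFree D) (a : ℕ)
    (hk : 3 * a + 2 ≤ Fintype.card V) (z : V) (hd3 : 3 ≤ deg D z) (A' : Finset {v : V // v ≠ z}) (hA'card : A'.card = a) (hB : BipSub (del D z) A')
    (hm' : (del D z).edgeFinset.card + (deg D z + 2) = a * (Fintype.card {v : V // v ≠ z} - a))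
    (hcap : ∀ v, deg D v ≤ (Fintype.card V - a - 2) + 1) (w₀ : {v : V // v ≠ z}) (hw₀A : w₀ ∉ A')
    (hw₀z : D.Adj w₀.1 z) (w₁ : {v : V // v ≠ z}) (hw₁A : w₁ ∈ A') (hw₁z : D.Adj w₁.1 z) :
    ∃ t s₀, t + s₀ = deg D z ∧ 1 ≤ t ∧ 1 ≤ s₀ ∧
      ((2 ≤ s₀ ∧ ∑ w : {v : V // v ≠ z}, (if D.Adj w.1 z then deg (del D z) w else 0) ≤
          t * (Fintype.card V - a - s₀) + s₀ * (a + 1 - t)) ∨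
       (s₀ = 1 ∧ (¬ ∃ v, MissingStar (del D z) A' v) ∧
          ∑ w : {v : V // v ≠ z}, (if D.Adj w.1 z then deg (del D z) w else 0) ≤
            t * (Fintype.card V - a - 2) + (a + 1 - t)) ∨
       (s₀ = 1 ∧ deg D z + 2 ≤ a ∧
          ∑ w : {v : V // v ≠ z}, (if D.Adj w.1 z then deg (del D z) w else 0) ≤
            t * (Fintype.card V - a - 2) + (a - (deg D z + 2)))) := by
  have hcard' := card_del z
  obtain ⟨Nz, hNzdef⟩ : ∃ Nz : Finset {v : V // v ≠ z},
      Nz = univ.filter (fun w : {v : V // v ≠ z} => D.Adj w.1 z) := ⟨_, rfl⟩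
  have hmemNz : ∀ w : {v : V // v ≠ z}, w ∈ Nz ↔ D.Adj w.1 z := fun w => by
    rw [hNzdef, mem_filter]
    simp only [mem_univ, true_and]
  have hNz : Nz.card = deg D z := by rw [hNzdef]; exact card_nbhd_del D z
  have hTfilt : ∑ w : {v : V // v ≠ z}, (if D.Adj w.1 z then deg (del D z) w else 0) =
      ∑ w ∈ Nz, deg (del D z) w := by
    rw [hNzdef, sum_filter]
  rw [hTfilt]
  have hdegNz : ∀ w ∈ Nz, deg (del D z) w + 1 ≤ Fintype.card V - a - 1 := fun w hw => by
    have h := deg_del D z w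
    rw [if_pos ((hmemNz w).mp hw)] at h
    have := hcap w.1
    omega
  -- the in-side and off-side neighbours of `z`
  obtain ⟨I, hI⟩ : ∃ I : Finset {v : V // v ≠ z}, I = Nz.filter (fun w => w ∈ A') := ⟨_, rfl⟩
  obtain ⟨O, hO⟩ : ∃ O : Finset {v : V // v ≠ z}, O = Nz.filter (fun w => w ∉ A') := ⟨_, rfl⟩
  have hIO : I.card + O.card = deg D z := by
    rw [hI, hO, card_filter_add_card_filter_not, hNz]
  have hIeq : I = A'.filter (fun w => D.Adj w.1 z) := by
    rw [hI]
    ext w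
    rw [mem_filter, mem_filter, hmemNz]
    tauto
  have hOeq : O = A'ᶜ.filter (fun w => D.Adj w.1 z) := by
    rw [hO]
    ext w
    rw [mem_filter, mem_filter, hmemNz, mem_compl]
    tauto
  have hTsplit : ∑ w ∈ Nz, deg (del D z) w = ∑ w ∈ I, deg (del D z) w + ∑ w ∈ O, deg (del D z) w := by
    rw [hI, hO, sum_filter_add_sum_filter_not]
  have hTI : ∑ w ∈ I, deg (del D z) w ≤ I.card * (Fintype.card V - a - 2) := by
    rw [← smul_eq_mul, ← sum_const]
    apply sum_le_sum
    intro w hw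
    have := hdegNz w (mem_of_mem_filter w (hI ▸ hw))
    omega
  have hoff : ∀ w ∈ O, deg (del D z) w + I.card ≤ a + 1 := fun w hw => by
    rw [hO, mem_filter, hmemNz] at hw
    have h := offside_deg_bound D hK z A' hB w hw.2 hw.1
    rw [← hIeq, hA'card] at h
    exact h
  have hTO : ∑ w ∈ O, deg (del D z) w ≤ O.card * (a + 1 - I.card) := by
    rw [← smul_eq_mul, ← sum_const]
    apply sum_le_sum
    intro w hw
    have := hoff w hw
    omega
  have hw₀O : w₀ ∈ O := by rw [hO, mem_filter, hmemNz]; exact ⟨hw₀z, hw₀A⟩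
  have hw₁I : w₁ ∈ I := by rw [hI, mem_filter, hmemNz]; exact ⟨hw₁z, hw₁A⟩
  have hO1 : 1 ≤ O.card := card_pos.mpr ⟨w₀, hw₀O⟩
  have hI1 : 1 ≤ I.card := card_pos.mpr ⟨w₁, hw₁I⟩
  refine ⟨I.card, O.card, hIO, hI1, hO1, ?_⟩
  rcases Nat.lt_or_ge O.card 2 with hO2 | hO2
  · -- a single off-side neighbour
    have hOcard : O.card = 1 := by omega
    have hOeq' : O = {w₀} := by
      apply (eq_singleton_iff_unique_mem).mpr ⟨hw₀O, fun w hw => ?_⟩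
      exact card_le_one.mp (by omega : O.card ≤ 1) w hw w₀ hw₀O
    have hTO' : ∑ w ∈ O, deg (del D z) w = deg (del D z) w₀ := by rw [hOeq', sum_singleton]
    have hdw₀ : deg (del D z) w₀ + I.card ≤ a + 1 := hoff w₀ hw₀O
    by_cases hstar : ∃ v, MissingStar (del D z) A' v
    · -- THE STAR CASE: the centre is `w₀` — an in-side neighbour `x₁` is not adjacent to `w₀` (at most one is), so the
      -- centre is `x₁` or `w₀`; it is not `x₁`: a second in-side neighbour `u₂ ≠ x₁` misses some `y₂ ∉ A′` (no
      -- vertex at the cap), so `u₂ = v` or `y₂ = v`, both impossible for `v = x₁ ∈ A′`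
      right; right
      obtain ⟨v, hv⟩ := hstar
      have hmiss : ∀ u ∈ I, ∃ y : {v : V // v ≠ z}, y ∉ A' ∧ ¬ (del D z).Adj u y := by
        intro u hu
        have huA : u ∈ A' := (mem_filter.mp (hI ▸ hu)).2
        have huz : D.Adj u.1 z := (hmemNz u).mp (mem_of_mem_filter u (hI ▸ hu))
        have hdel := deg_del D z u
        rw [if_pos huz] at hdel
        have hc := hcap u.1
        have hsum := deg_add_deg_missingGraph (del D z) A' hB u
        rw [if_pos huA, hA'card] at hsum
        have hpos : 0 < deg (missingGraph (del D z) A') u := by omega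
        unfold deg at hpos
        obtain ⟨y, hy⟩ := card_pos.mp hpos
        rw [mem_filter, missingGraph_adj] at hy
        exact ⟨y, fun hyA => (hy.2.1.mp huA) hyA, hy.2.2⟩
      have hone : (I.filter (fun w => (del D z).Adj w₀ w)).card ≤ 1 := by
        by_contra hcon
        push Not at hcon
        obtain ⟨x₁, hx₁, x₂, hx₂, hne⟩ := one_lt_card.mp hcon
        rw [mem_filter] at hx₁ hx₂
        have hx₁z := (hmemNz x₁).mp (mem_of_mem_filter x₁ (hI ▸ hx₁.1))
        have hx₂z := (hmemNz x₂).mp (mem_of_mem_filter x₂ (hI ▸ hx₂.1))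
        exact not_adj_both D hK (D.adj_symm hw₀z) (D.adj_symm hx₁z) ((del_adj D z w₀ x₁).mp hx₁.2)
          (fun h => hne (Subtype.ext h)) (D.adj_symm hx₂z) ((del_adj D z w₀ x₂).mp hx₂.2)
      have hge : 0 < (I.filter (fun w => ¬ (del D z).Adj w₀ w)).card := by
        have := card_filter_add_card_filter_not (s := I) (fun w => (del D z).Adj w₀ w)
        omega
      obtain ⟨x₁, hx₁⟩ := card_pos.mp hge
      rw [mem_filter] at hx₁
      have hx₁A : x₁ ∈ A' := (mem_filter.mp (hI ▸ hx₁.1)).2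
      have hvw₀ : v = w₀ := by
        rcases hv x₁ w₀ hx₁A hw₀A (fun h => hx₁.2 ((del D z).adj_symm h)) with h | h
        · exfalso
          have h2 : 1 < I.card := by omega
          obtain ⟨u₂, hu₂, hne⟩ := exists_mem_ne h2 x₁
          obtain ⟨y₂, hy₂A, hy₂⟩ := hmiss u₂ hu₂
          have hu₂A : u₂ ∈ A' := (mem_filter.mp (hI ▸ hu₂)).2
          rcases hv u₂ y₂ hu₂A hy₂A hy₂ with h' | h'
          · exact hne (h'.trans h.symm)
          · apply hy₂A
            rw [h'.trans h.symm]
            exact hx₁A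
        · exact h.symm
      subst hvw₀
      -- every missing edge contains `w₀`: its missing degree is `d + 2`
      have hall : ∀ e ∈ (missingGraph (del D z) A').edgeFinset, v ∈ e := by
        intro e he
        revert he
        refine Sym2.ind (fun x y he => ?_) e
        rw [SimpleGraph.mem_edgeFinset, SimpleGraph.mem_edgeSet, missingGraph_adj] at he
        rw [Sym2.mem_iff]
        by_cases hxA : x ∈ A'
        · have hyA : y ∉ A' := he.1.mp hxA
          rcases hv x y hxA hyA he.2 with h | h
          · exact absurd h (fun h => hw₀A (h ▸ hxA))
          · exact Or.inr h.symm
        · have hyA : y ∈ A' := by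
            by_contra hyA
            exact hxA (he.1.mpr hyA)
          rcases hv y x hyA hxA (fun h => he.2 ((del D z).adj_symm h)) with h | h
          · exact absurd h (fun h => hw₀A (h ▸ hyA))
          · exact Or.inl h.symm
      have hdegm := deg_eq_card_edges_of_forall (missingGraph (del D z) A') v hall
      rw [card_edges_missingGraph (del D z) A' hB a (deg D z + 2) hA'card hm'] at hdegm
      have hsum := deg_add_deg_missingGraph (del D z) A' hB v
      rw [if_neg hw₀A, hA'card, hdegm] at hsum
      refine ⟨hOcard, by omega, ?_⟩
      rw [hTsplit, hTO']
      have : deg (del D z) v = a - (deg D z + 2) := by omega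
      omega
    · -- THE NON-STAR CASE
      right; left
      refine ⟨hOcard, hstar, ?_⟩
      rw [hTsplit, hTO']
      omega
  · -- `≥ 2` off-side neighbours: each in-side neighbour at `≤ k − a − s₀`, each off-side one at `≤ a + 1 − t`
    left
    refine ⟨hO2, ?_⟩
    have hin : ∀ u ∈ I, deg (del D z) u + O.card ≤ (Fintype.card V - a - 1) + 1 := fun u hu => by
      rw [hI, mem_filter, hmemNz] at hu
      have h := inside_deg_bound D hK z A' hB u hu.2 hu.1
      rw [← hOeq, card_compl, hA'card] at h
      have : Fintype.card {v : V // v ≠ z} - a = Fintype.card V - a - 1 := by omega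
      rw [this] at h
      exact h
    have hTI' : ∑ w ∈ I, deg (del D z) w ≤ I.card * (Fintype.card V - a - O.card) := by
      rw [← smul_eq_mul, ← sum_const]
      apply sum_le_sum
      intro w hw
      have := hin w hw
      omega
    rw [hTsplit]
    omega

/-- **THE MIXED READ AT `d = a − 2` ON `(k, a, a + 2)`, `5 ≤ a`, `3a + 2 ≤ k`:** `D − z ⊆ K(A′, A′ᶜ)` with `a`
missing pairs, a neighbour of `z` off the side and one on it ⇒ the triple-broom target. -/
theorem rowA2_last_mixed_two' (D : SimpleGraph V) [DecidableRel D.Adj] (hK : K4mFree D) (a : ℕ) (ha5 : 5 ≤ a)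
    (hk : 3 * a + 2 ≤ Fintype.card V) (hm : D.edgeFinset.card + (a + 2) = a * (Fintype.card V - a)) (z : V)
    (hz : deg D z = a - 2) (A' : Finset {v : V // v ≠ z}) (hA'card : A'.card = a) (hB : BipSub (del D z) A')
    (hm' : (del D z).edgeFinset.card + (deg D z + 2) = a * (Fintype.card {v : V // v ≠ z} - a))
    (hcap : ∀ v, deg D v ≤ (Fintype.card V - a - 2) + 1) (w₀ : {v : V // v ≠ z}) (hw₀A : w₀ ∉ A')
    (hw₀z : D.Adj w₀.1 z) (w₁ : {v : V // v ≠ z}) (hw₁A : w₁ ∈ A') (hw₁z : D.Adj w₁.1 z) :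
    ∑ v, deg D v * deg D v + (a + 2) * (Fintype.card V - 1 - (a + 2)) + (2 * Fintype.card V + 2 * a - 14) ≤
      D.edgeFinset.card * Fintype.card V := by
  have hcard' := card_del z
  have hedges' := card_edges_del D z
  have hsq := sum_deg_sq_del D z
  obtain ⟨t, s₀, hts, ht1, hs₀1, hcases⟩ :=
    rowA2_mixed_core' D hK a hk z (by omega) A' hA'card hB hm' hcap w₀ hw₀A hw₀z w₁ hw₁A hw₁z
  obtain ⟨T, hTdef⟩ : ∃ T, ∑ w : {v : V // v ≠ z}, (if D.Adj w.1 z then deg (del D z) w else 0) = T := ⟨_, rfl⟩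
  obtain ⟨S', hS'def⟩ : ∃ S', ∑ w : {v : V // v ≠ z}, deg (del D z) w * deg (del D z) w = S' := ⟨_, rfl⟩
  obtain ⟨m', hm'def⟩ : ∃ m', (del D z).edgeFinset.card = m' := ⟨_, rfl⟩
  rw [hTdef, hS'def] at hsq
  rw [hTdef] at hcases
  rw [hm'def] at hedges'
  have hcardV' : Fintype.card {v : V // v ≠ z} = Fintype.card V - 1 := by omega
  have hmd : m' + (a - 2) + (a + 2) = a * (Fintype.card V - a) := by omega
  have hm'a : (del D z).edgeFinset.card + a = a * (Fintype.card {v : V // v ≠ z} - a) := by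
    have h := hm'
    rw [hz] at h
    have e : a - 2 + 2 = a := by omega
    rw [e] at h
    exact h
  rw [hsq, ← hedges', hz]
  rcases hcases with ⟨hs₀2, hT⟩ | ⟨hs₀, hstar, hT⟩ | ⟨hs₀, hda, hT⟩
  · have hS := sum_deg_sq_le_of_bipSub (del D z) A' hB a a hA'card hm'a (by omega)
    rw [hS'def, hm'def, hcardV'] at hS
    exact rowA2_two_mixed_ref' a t s₀ (Fintype.card V) m' S' T ha5 hk (by omega) hs₀2 ht1 hmd hS hT
  · have hS := closed_form_stability_bipSub (del D z) A' hB a a hA'card hm'a (by omega) (by omega) hstar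
    rw [hS'def, hm'def, hcardV'] at hS
    have ht : t = a - 3 := by omega
    rw [ht] at hT
    have e : a + 1 - (a - 3) = 4 := by omega
    rw [e] at hT
    exact rowA2_two_nonstar' a (Fintype.card V) m' S' T ha5 hk hmd hS hT
  · have hS := sum_deg_sq_le_of_bipSub (del D z) A' hB a a hA'card hm'a (by omega)
    rw [hS'def, hm'def, hcardV'] at hS
    have ht : t = a - 3 := by omega
    rw [ht, hz] at hT
    have e : a - (a - 2 + 2) = 0 := by omega
    rw [e, add_zero] at hT
    exact rowA2_two_star0' a (Fintype.card V) m' S' T ha5 hk hmd hS hT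

/-- **THE MIXED READ AT `d = a − 1` ON `(k, a, a + 2)`, `5 ≤ a`, `3a + 2 ≤ k`:** `D − z ⊆ K(A′, A′ᶜ)` with `a + 1`
missing pairs, a neighbour of `z` off the side and one on it ⇒ the triple-broom target (the missing star is impossible:
its centre would miss `a + 1` vertices of `A′`). -/
theorem rowA2_last_mixed_one' (D : SimpleGraph V) [DecidableRel D.Adj] (hK : K4mFree D) (a : ℕ) (ha5 : 5 ≤ a)
    (hk : 3 * a + 2 ≤ Fintype.card V) (hm : D.edgeFinset.card + (a + 2) = a * (Fintype.card V - a)) (z : V)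
    (hz : deg D z = a - 1) (A' : Finset {v : V // v ≠ z}) (hA'card : A'.card = a) (hB : BipSub (del D z) A')
    (hm' : (del D z).edgeFinset.card + (deg D z + 2) = a * (Fintype.card {v : V // v ≠ z} - a))
    (hcap : ∀ v, deg D v ≤ (Fintype.card V - a - 2) + 1) (w₀ : {v : V // v ≠ z}) (hw₀A : w₀ ∉ A')
    (hw₀z : D.Adj w₀.1 z) (w₁ : {v : V // v ≠ z}) (hw₁A : w₁ ∈ A') (hw₁z : D.Adj w₁.1 z) :
    ∑ v, deg D v * deg D v + (a + 2) * (Fintype.card V - 1 - (a + 2)) + (2 * Fintype.card V + 2 * a - 14) ≤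
      D.edgeFinset.card * Fintype.card V := by
  have hcard' := card_del z
  have hedges' := card_edges_del D z
  have hsq := sum_deg_sq_del D z
  obtain ⟨t, s₀, hts, ht1, hs₀1, hcases⟩ :=
    rowA2_mixed_core' D hK a hk z (by omega) A' hA'card hB hm' hcap w₀ hw₀A hw₀z w₁ hw₁A hw₁z
  obtain ⟨T, hTdef⟩ : ∃ T, ∑ w : {v : V // v ≠ z}, (if D.Adj w.1 z then deg (del D z) w else 0) = T := ⟨_, rfl⟩
  obtain ⟨S', hS'def⟩ : ∃ S', ∑ w : {v : V // v ≠ z}, deg (del D z) w * deg (del D z) w = S' := ⟨_, rfl⟩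
  obtain ⟨m', hm'def⟩ : ∃ m', (del D z).edgeFinset.card = m' := ⟨_, rfl⟩
  rw [hTdef, hS'def] at hsq
  rw [hTdef] at hcases
  rw [hm'def] at hedges'
  have hcardV' : Fintype.card {v : V // v ≠ z} = Fintype.card V - 1 := by omega
  have hmd : m' + (a - 1) + (a + 2) = a * (Fintype.card V - a) := by omega
  have hm'a : (del D z).edgeFinset.card + (a + 1) = a * (Fintype.card {v : V // v ≠ z} - a) := by
    have h := hm'
    rw [hz] at h
    have e : a - 1 + 2 = a + 1 := by omega
    rw [e] at h
    exact h
  rw [hsq, ← hedges', hz]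
  rcases hcases with ⟨hs₀2, hT⟩ | ⟨hs₀, hstar, hT⟩ | ⟨_, hda, _⟩
  · have hS := sum_deg_sq_le_of_bipSub (del D z) A' hB a (a + 1) hA'card hm'a (by omega)
    rw [hS'def, hm'def, hcardV'] at hS
    exact rowA2_one_mixed_ref' a t s₀ (Fintype.card V) m' S' T ha5 hk (by omega) hs₀2 ht1 hmd hS hT
  · have hS := closed_form_stability_bipSub (del D z) A' hB a (a + 1) hA'card hm'a (by omega) (by omega) hstar
    rw [hS'def, hm'def, hcardV'] at hS
    have ht : t = a - 2 := by omega
    rw [ht] at hT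
    have e : a + 1 - (a - 2) = 3 := by omega
    have e2 : a + 1 - 2 = a - 1 := by omega
    rw [e] at hT
    rw [e2] at hS
    exact rowA2_one_nonstar' a (Fintype.card V) m' S' T ha5 hk hmd hS hT
  · exfalso
    omega

end C047

end TriangleCap

end PercRepro
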